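import Summits.BirchSwinnertonDyer.BirchSwinnertonDyer.Theorems.DerivedCoinvariantProfileDischarged
import Literature.NumberTheory.EllipticCurves.Kobayashi2003.SignedKatoDivisibility
import Literature.NumberTheory.EllipticCurves.Kobayashi2003.SignedSelmerDualExistsProofs
import Literature.NumberTheory.EllipticCurves.PlusMinusPAdicLFunctionProofs
import Literature.NumberTheory.EllipticCurves.Kobayashi2003.SignedSelmerCorankBoundProofs
import Literature.NumberTheory.EllipticCurves.BurungaleSkinnerTianWan2024.SignedMainStatementSemistableOPEN
import Literature.NumberTheory.EllipticCurves.SupersingularDensitySerreFrobeniusProofs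
import Summits.BirchSwinnertonDyer.BirchSwinnertonDyer.Theorems.QuadraticBranchSignedControlPlusEtaNonsurjThetaFunctionalEquationNormCoordinateRankBound
import HarnessLib

/-!
# The derived coinvariant profile at a SUPERSINGULAR prime: the signed excess-zero inequality
# `rank + corank Ш[p^∞] + Σ e_i(X^±) ≤ ord_T L_p^±`, its four-leg equality door, and all good `p ≥ 5`

Cell `bsd-rank2`, seat p2 (GEN 73, kernel K73-E). THEOREMS ONLY — no `def`, no new named fact, no
`sorry`. Companion of `DerivedCoinvariantProfileAtPoint.lean` (abstract point-level laws) and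
`DerivedCoinvariantProfileDischarged.lean` (K70-A: the ORDINARY case, Kato Thm. 17.4 + Greenberg control).
Here: every odd good SUPERSINGULAR prime with `a_p = 0` (every supersingular `p ≥ 5`), BOTH signs `ε`.

* §1 `rank_add_shaCorank_add_sum_derivedLength_le_order_signed` — granted ONLY the tree's named facts
  `thm41_signedCharIdeal_divisibility` (Kobayashi Thm. 1.3/4.1, `pⁿ L_p^ε ∈ Char(X^ε)`, from Kato's Euler
  system) and `thm12_signedSelmerDual_finite_torsion` (Thm. 1.2), for every datum `D` of `Sel^ε(E/ℚ_∞)`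
  and every `L = L_p^ε(E,X)`:
  `rank E(ℚ) + corank_{ℤ_p} Ш(E/ℚ)[p^∞] + ∑_{1 ≤ i ≤ n} e_{i+1}(X^ε(E/ℚ_∞)) ≤ ord_{X=0} L_p^ε(E,X)`,
  sharpening the tree's `Kobayashi2003.thm94_mordellWeilRank_le_order` (`rank ≤ ord`) by the `Ш`-corank and
  the higher derived coinvariant profile; NO control theorem is needed (only Greenberg's Lemma 3.1 on
  `Sel^ε`, tree theorem `SignedSelmerDualData.selmerCorank_le_coinvariantsRank`). `exists_signed_…`
  supplies datum, variable and a NON-ZERO `L_p^ε` (Pollack) from tree theorems.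
* §2 `defects_eq_zero_of_order_le_rank_signed` (squeeze) and `order_eq_rank_iff_four_legs_signed` (door):
  `ord_{X=0} L_p^ε = rank E(ℚ)` iff (MC_T^ε) `ℓ_{(T)}(X^ε) = ord_T L_p^ε` ∧ `e_2(X^ε) = 0` ∧
  `corank Ш[p^∞] = 0` ∧ (CT^ε) `rank_{ℤ_p} X^ε/TX^ε = corank Sel_{p^∞}(E/ℚ)`. The fourth leg is Kobayashi's
  control theorem 9.3 at layer `0` — PRINT, not a tree fact, hence DISPLAYED (the one input the
  supersingular door has beyond the ordinary one, where Greenberg's control is a tree theorem).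
* §3 `lengthAt_eq_order_of_signedCharIdealEq` — (MC_T^ε) from the signed main conjecture in the tree's
  OPEN-binder currency `SignedCharIdealEqPadicLFunctionNeron W p ε` ([BurungaleSkinnerTianWan2024]
  Thm. 10.1 for semistable `E`, ANNOUNCED; a hypothesis, never a theorem): on that locus the door reads
  `ord = rank ⟺ e_2(X^ε) = 0 ∧ corank Ш = 0 ∧ (CT^ε)`.
* §4 `rank_add_shaCorank_le_order_at_every_good_prime_ge_five` — the UNION with K70-A: for EVERY good
  `p ≥ 5` (ordinary or `a_p = 0`, `natCast_dvd_frobeniusTrace_iff_eq_zero`), granted Kato's resp.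
  Kobayashi's divisibility, `rank E(ℚ) + corank Ш[p^∞] + e_2` is bounded by the order of vanishing of the
  relevant cyclotomic `p`-adic `L`-function — the rank-≥ 2 `p`-adic BSD inequality for all `E` at all
  good `p ≥ 5`, with the equality door typed in both reduction types.

HONEST FRAMING. Nothing here moves S0: every statement is at one prime `p` and concerns `ord_T L_p^{(ε)}`,
never `ord_{s=1} L(E,s)`; the legs `corank Ш[p^∞] = 0`, `e_2 = 0` are barrier B1
(`Literature/Barriers/BirchSwinnertonDyer/SelmerVersusMordellWeil.lean`) read prime by prime.

-/

open scoped BigOperators MatrixGroups ModularForm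
open CongruenceSubgroup

namespace Summit.BirchSwinnertonDyer.BirchSwinnertonDyer.Theorems.DerivedCoinvariantProfileSigned

open Literature.NumberTheory.EllipticCurves Literature.NumberTheory.EllipticCurves.IwasawaAlgebra
  Literature.NumberTheory.EllipticCurves.Kobayashi2003 Literature.NumberTheory.EllipticCurves.ModularForms
  Literature.NumberTheory.EllipticCurves.BurungaleSkinnerTianWan2024
open Summit.BirchSwinnertonDyer.BirchSwinnertonDyer.Theorems.DerivedCoinvariantProfile
  Summit.BirchSwinnertonDyer.BirchSwinnertonDyer.Theorems.DerivedCoinvariantProfileAtPoint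

variable (p : ℕ) [Fact p.Prime]
variable (W : WeierstrassCurve ℚ) [W.IsElliptic] [W.IsGloballyMinimal]
  {κ : ZpExtension ℚ p} {γ : Field.absoluteGaloisGroup ℚ} {ε : ℤˣ}

/-! ## §0 An order computation in `Λ = ℤ_p⟦T⟧` (`ord (pⁿ·L) = ord L` is the tree's
`EtaThetaFunctionalEquation.order_natCast_pow_mul`) -/
/-- If `ι(g) = ϖ · ι(L)` in `ℚ_p⟦T⟧` with `ϖ ∈ ℚ^×` then `ord_T g = ord_T L`. [cite: MazurTateTeitelbaum1986, §I.12] -/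
theorem order_eq_of_iwasawaToPowerSeries_eq_C_mul {g L : IwasawaAlgebra p} {ϖ : ℚ} (hϖ : ϖ ≠ 0)
    (h : iwasawaToPowerSeries p g = PowerSeries.C (ϖ : ℚ_[p]) * iwasawaToPowerSeries p L) :
    g.order = L.order := by
  have hu : IsUnit (PowerSeries.C (ϖ : ℚ_[p])) :=
    IsUnit.map PowerSeries.C (IsUnit.mk0 _ (by exact_mod_cast hϖ))
  rw [← order_iwasawaToPowerSeries p g, ← order_iwasawaToPowerSeries p L, h, PowerSeries.order_mul,
    PowerSeries.order_zero_of_unit hu, zero_add]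

/-! ## §1 The signed excess-zero inequality (Kobayashi's facts only; no control theorem) -/
omit [W.IsElliptic] [W.IsGloballyMinimal] in
/-- `ℓ_{(T)}(X^ε) ≤ ord_{X=0} L` as soon as `pⁿ L ∈ Char(X^ε)` for some `n` (`X^ε` finitely generated
`Λ`-torsion): structure theory (`lengthAt_primeT_le_order`) and §0.
[cite: Kobayashi2003, Thm. 4.1 (p. 8)] [cite: GreenbergLNM1716, Thm. 1.2] -/
theorem lengthAt_le_order_of_pow_mul_mem_charIdeal (D : SignedSelmerDualData W κ γ ε)
    [Module.Finite (IwasawaAlgebra p) D.X] (hX : Module.IsTorsion (IwasawaAlgebra p) D.X)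
    {L : IwasawaAlgebra p} (hL : ∃ n : ℕ, (p : IwasawaAlgebra p) ^ n * L ∈ D.charIdeal) :
    Module.lengthAt (IwasawaAlgebra p) D.X (primeT p) ≤ L.order := by
  obtain ⟨n, hn⟩ := hL
  simpa only [EtaThetaFunctionalEquation.order_natCast_pow_mul] using
    lengthAt_primeT_le_order D.X hX _ hn

omit [W.IsGloballyMinimal] in
/-- **The algebraic chain, unconditionally** (any `ℤ_p`-extension datum, `X^ε` finitely generated):
`corank_{ℤ_p} Sel_{p^∞}(E/ℚ) + ∑_{1 ≤ i ≤ n} e_{i+1}(X^ε) ≤ ℓ_{(T)}(X^ε)` — easy half of control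
`corank Sel ≤ e_1(X^ε)` (`SignedSelmerDualData.selmerCorank_le_coinvariantsRank`) and the profile law
(`sum_derivedLength_le`). [cite: GreenbergLNM1716, §3 Lemma 3.1 (p. 86)] [cite: BertoliniDarmon1995, §2] -/
theorem selmerCorank_add_sum_derivedLength_le_lengthAt (hγ : κ.IsTopGenerator γ)
    (D : SignedSelmerDualData W κ γ ε) [Module.Finite (IwasawaAlgebra p) D.X] (n : ℕ) :
    (W.selmerCorank p : ℕ∞) + ∑ i ∈ Finset.Ico 1 (n + 1), derivedLength p D.X i ≤
      Module.lengthAt (IwasawaAlgebra p) D.X (primeT p) := by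
  have h0 : (W.selmerCorank p : ℕ∞) ≤ derivedLength p D.X 0 := by
    rw [derivedLength_zero_eq_coinvariantsRank]
    exact_mod_cast D.selmerCorank_le_coinvariantsRank hγ
  calc (W.selmerCorank p : ℕ∞) + ∑ i ∈ Finset.Ico 1 (n + 1), derivedLength p D.X i
      ≤ derivedLength p D.X 0 + ∑ i ∈ Finset.Ico 1 (n + 1), derivedLength p D.X i :=
        add_le_add h0 le_rfl
    _ = ∑ i ∈ Finset.range (n + 1), derivedLength p D.X i := by
        rw [Finset.range_eq_Ico, Finset.sum_eq_sum_Ico_succ_bot (Nat.succ_pos n)]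
    _ ≤ Module.lengthAt (IwasawaAlgebra p) D.X (primeT p) := sum_derivedLength_le p D.X (n + 1)

/-- **Signed derived excess-zero inequality (K73-E).** Granted the tree's named facts
`thm41_signedCharIdeal_divisibility` (Kobayashi Thm. 1.3/4.1) and `thm12_signedSelmerDual_finite_torsion`
(Thm. 1.2): for `W` globally minimal, `p ≠ 2` good with `a_p = 0`, `f` the newform of `W`, the cyclotomic
variable `(κ, γ)`, either sign `ε`, every `L = L_p^ε(E,X)`, every datum `D` of `Sel^ε(E/ℚ_∞)` and every `n`:
`rank E(ℚ) + corank_{ℤ_p} Ш(E/ℚ)[p^∞] + ∑_{1 ≤ i ≤ n} e_{i+1}(X^ε(E/ℚ_∞)) ≤ ord_{X=0} L_p^ε(E,X)`.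
No control theorem, no Galois-image hypothesis, no main conjecture (`n = 0`: Kobayashi's Thm. 9.4,
tree `thm94_mordellWeilRank_le_order`). [cite: Kobayashi2003, Thm. 1.2 (p. 2), Thm. 4.1 (p. 8), Thm. 9.4 (p. 27)]
[cite: Kato2004Asterisque, Thm. 17.4 (p. 273)] [cite: GreenbergLNM1716, §3 Lemma 3.1] [cite: BertoliniDarmon1995, §2] -/
theorem rank_add_shaCorank_add_sum_derivedLength_le_order_signed
    (h41 : thm41_signedCharIdeal_divisibility) (h12 : thm12_signedSelmerDual_finite_torsion)
    (hp : p ≠ 2) (hgood : W.HasGoodReductionAtPrime p) (hap : W.frobeniusTrace p = 0)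
    {N : ℕ} [NeZero N] {f : CuspForm (Gamma0 N) 2} (hf : IsNewformOf W f)
    (hκ : κ.IsCyclotomic) (hγ : κ.IsTopGenerator γ) (hγ' : IsCyclotomicVariable p γ)
    {L : IwasawaAlgebra p} (hL : IsSignedPAdicLFunction f p ε L)
    (D : SignedSelmerDualData W κ γ ε) (n : ℕ) :
    (W.mordellWeilRank : ℕ∞) + W.shaCorank p + ∑ i ∈ Finset.Ico 1 (n + 1), derivedLength p D.X i ≤
      L.order := by
  haveI : Module.Finite (IwasawaAlgebra p) D.X := h12.moduleFinite hp hgood hap hκ hγ D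
  have hX : Module.IsTorsion (IwasawaAlgebra p) D.X := h12.isTorsion hp hgood hap hκ hγ D
  have hKD := h41.rational hp hgood hap hf hκ hγ hγ' hL D hX
  have hid : W.selmerCorank p = W.mordellWeilRank + W.shaCorank p :=
    W.selmerCorank_eq_mordellWeilRank_add_holds p
  have h1 := selmerCorank_add_sum_derivedLength_le_lengthAt p W hγ D n
  rw [hid, Nat.cast_add] at h1
  exact h1.trans (lengthAt_le_order_of_pow_mul_mem_charIdeal p W D hX hKD)

/-- **The first higher term alone**: `rank E(ℚ) + corank_{ℤ_p} Ш(E/ℚ)[p^∞] + e_2(X^ε(E/ℚ_∞)) ≤ ord_{X=0} L_p^ε`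
(`e_2(X^ε) = ℓ_{(T)}(TX^ε/T²X^ε)`). [cite: Kobayashi2003, Thm. 4.1 (p. 8)] [cite: Howard2004DerivedHeights, Cor. 5.3] -/
theorem rank_add_shaCorank_add_derivedLength_one_le_order_signed
    (h41 : thm41_signedCharIdeal_divisibility) (h12 : thm12_signedSelmerDual_finite_torsion)
    (hp : p ≠ 2) (hgood : W.HasGoodReductionAtPrime p) (hap : W.frobeniusTrace p = 0)
    {N : ℕ} [NeZero N] {f : CuspForm (Gamma0 N) 2} (hf : IsNewformOf W f)
    (hκ : κ.IsCyclotomic) (hγ : κ.IsTopGenerator γ) (hγ' : IsCyclotomicVariable p γ)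
    {L : IwasawaAlgebra p} (hL : IsSignedPAdicLFunction f p ε L)
    (D : SignedSelmerDualData W κ γ ε) :
    (W.mordellWeilRank : ℕ∞) + W.shaCorank p + derivedLength p D.X 1 ≤ L.order := by
  simpa using rank_add_shaCorank_add_sum_derivedLength_le_order_signed p W h41 h12 hp hgood hap hf
    hκ hγ hγ' hL D 1

/-- **Non-vacuity**: granted the two Kobayashi facts, for every sign there ARE a cyclotomic datum
`(κ, γ)`, a datum `D` of `Sel^ε(E/ℚ_∞)` and a NON-ZERO `L = L_p^ε(E,X) ∈ Λ` (Pollack's existence is the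
tree theorem `pollack_exists_plusMinusPAdicLFunction_holds`) satisfying the inequality for every `n`; so
`ord_{X=0} L_p^ε < ∞` bounds every higher derived length. [cite: Kobayashi2003, Thm. 3.2 (p. 7), Thm. 4.1 (p. 8)]
[cite: Pollack2003, Thm. 5.6, Cor. 5.11] -/
theorem exists_signed_rank_add_shaCorank_add_sum_derivedLength_le_order
    (h41 : thm41_signedCharIdeal_divisibility) (h12 : thm12_signedSelmerDual_finite_torsion)
    (hp : p ≠ 2) (hgood : W.HasGoodReductionAtPrime p) (hap : W.frobeniusTrace p = 0)
    {N : ℕ} [NeZero N] {f : CuspForm (Gamma0 N) 2} (hf : IsNewformOf W f) (ε : ℤˣ) :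
    ∃ (κ : ZpExtension ℚ p) (γ : Field.absoluteGaloisGroup ℚ) (D : SignedSelmerDualData W κ γ ε)
      (L : IwasawaAlgebra p), κ.IsCyclotomic ∧ κ.IsTopGenerator γ ∧ IsCyclotomicVariable p γ ∧
        L ≠ 0 ∧ IsSignedPAdicLFunction f p ε L ∧ ∀ n : ℕ, (W.mordellWeilRank : ℕ∞) + W.shaCorank p +
          ∑ i ∈ Finset.Ico 1 (n + 1), derivedLength p D.X i ≤ L.order := by
  obtain ⟨κ, hκ, γ, hγ, hγ'⟩ := exists_isCyclotomic_isTopGenerator_isCyclotomicVariable_holds p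
  obtain ⟨D⟩ := nonempty_signedSelmerDualData W κ ε hγ
  obtain ⟨L, hL0, hL⟩ :=
    exists_isSignedPAdicLFunction pollack_exists_plusMinusPAdicLFunction_holds hp hf hgood hap ε
  exact ⟨κ, γ, D, L, hκ, hγ, hγ', hL0, hL, fun n ↦
    rank_add_shaCorank_add_sum_derivedLength_le_order_signed p W h41 h12 hp hgood hap hf hκ hγ hγ' hL D n⟩

/-! ## §2 The squeeze and the four-leg door at a supersingular prime -/
/-- **Squeeze (signed).** Granted only the two Kobayashi facts: `ord_{X=0} L_p^ε(E,X) ≤ rank E(ℚ)`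
forces `corank_{ℤ_p} Ш(E/ℚ)[p^∞] = 0`, the signed control defect to vanish
(`rank_{ℤ_p} X^ε/TX^ε = corank Sel_{p^∞}(E/ℚ) = rank E(ℚ)`), every higher derived length of `X^ε` to
vanish, (MC_T^ε) `ℓ_{(T)}(X^ε) = ord_T L_p^ε`, and `ord_{X=0} L_p^ε = rank E(ℚ)`.
[cite: Kobayashi2003, Thm. 4.1 (p. 8), Thm. 9.4 (p. 27)] [cite: GreenbergLNM1716, §3 Lemma 3.1] [cite: BertoliniDarmon1995, §2] -/
theorem defects_eq_zero_of_order_le_rank_signed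
    (h41 : thm41_signedCharIdeal_divisibility) (h12 : thm12_signedSelmerDual_finite_torsion)
    (hp : p ≠ 2) (hgood : W.HasGoodReductionAtPrime p) (hap : W.frobeniusTrace p = 0)
    {N : ℕ} [NeZero N] {f : CuspForm (Gamma0 N) 2} (hf : IsNewformOf W f)
    (hκ : κ.IsCyclotomic) (hγ : κ.IsTopGenerator γ) (hγ' : IsCyclotomicVariable p γ)
    {L : IwasawaAlgebra p} (hL : IsSignedPAdicLFunction f p ε L)
    (D : SignedSelmerDualData W κ γ ε) [Module.Finite (IwasawaAlgebra p) D.X]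
    (hle : L.order ≤ W.mordellWeilRank) :
    W.shaCorank p = 0 ∧ coinvariantsRank p D.X = W.selmerCorank p ∧
      W.selmerCorank p = W.mordellWeilRank ∧ (∀ i, 1 ≤ i → derivedLength p D.X i = 0) ∧
      Module.lengthAt (IwasawaAlgebra p) D.X (primeT p) = L.order ∧
      L.order = W.mordellWeilRank := by
  have hX : Module.IsTorsion (IwasawaAlgebra p) D.X := h12.isTorsion hp hgood hap hκ hγ D
  have hKD := h41.rational hp hgood hap hf hκ hγ hγ' hL D hX
  have hid : W.selmerCorank p = W.mordellWeilRank + W.shaCorank p :=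
    W.selmerCorank_eq_mordellWeilRank_add_holds p
  have hineq := rank_add_shaCorank_add_derivedLength_one_le_order_signed p W h41 h12 hp hgood hap hf
    hκ hγ hγ' hL D
  have h0 : (W.shaCorank p : ℕ∞) + derivedLength p D.X 1 ≤ 0 := by
    rw [← ENat.add_le_add_iff_left (ENat.coe_ne_top W.mordellWeilRank), add_zero, ← add_assoc]
    exact hineq.trans hle
  have hsha : W.shaCorank p = 0 := by
    exact_mod_cast (nonpos_iff_eq_zero.mp (le_self_add.trans h0) : (W.shaCorank p : ℕ∞) = 0)
  have he1 : derivedLength p D.X 1 = 0 := nonpos_iff_eq_zero.mp (le_add_self.trans h0)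
  -- the chain `rank ≤ corank Sel ≤ rank X^ε/TX^ε ≤ ℓ_{(T)}(X^ε) ≤ ord L ≤ rank`
  have hc : W.selmerCorank p ≤ coinvariantsRank p D.X := D.selmerCorank_le_coinvariantsRank hγ
  have hup := lengthAt_le_order_of_pow_mul_mem_charIdeal p W D hX hKD
  have hcl : (coinvariantsRank p D.X : ℕ∞) ≤ Module.lengthAt (IwasawaAlgebra p) D.X (primeT p) :=
    coinvariantsRank_le_lengthAt_primeT D.X
  have hcr' : coinvariantsRank p D.X ≤ W.mordellWeilRank := by exact_mod_cast hcl.trans (hup.trans hle)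
  have hsel : W.selmerCorank p = W.mordellWeilRank := by rw [hid, hsha, Nat.add_zero]
  have hctrl : coinvariantsRank p D.X = W.selmerCorank p := by omega
  have hlow : (W.mordellWeilRank : ℕ∞) ≤ Module.lengthAt (IwasawaAlgebra p) D.X (primeT p) := by
    refine le_trans ?_ hcl
    exact_mod_cast (show W.mordellWeilRank ≤ coinvariantsRank p D.X by omega)
  exact ⟨hsha, hctrl, hsel, fun i hi ↦ derivedLength_eq_zero_of_eq_zero p hi he1,
    le_antisymm hup (hle.trans hlow), le_antisymm hle (hlow.trans hup)⟩

/-- **The four-leg door at a supersingular prime (K73-E).** Granted the two Kobayashi facts, at an odd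
good `p` with `a_p = 0`, either sign, every datum: `ord_{X=0} L_p^ε(E,X) = rank E(ℚ)` **iff** (MC_T^ε)
`ℓ_{(T)}(X^ε) = ord_{X=0} L_p^ε` ∧ `e_2(X^ε(E/ℚ_∞)) = 0` ∧ `corank_{ℤ_p} Ш(E/ℚ)[p^∞] = 0` ∧ (CT^ε)
`rank_{ℤ_p} X^ε/TX^ε = corank Sel_{p^∞}(E/ℚ)` — the last leg is Kobayashi's control theorem (Thm. 9.3 at
layer `0`), PRINT but not a tree fact: the only extra input over the ordinary door of Part II.
[cite: Kobayashi2003, Thm. 4.1 (p. 8), Thm. 9.3, Thm. 9.4 (p. 27)] [cite: GreenbergLNM1716, §3 Lemma 3.1]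
[cite: BertoliniDarmon1995, §2] [cite: Howard2004DerivedHeights, Cor. 5.3] -/
theorem order_eq_rank_iff_four_legs_signed
    (h41 : thm41_signedCharIdeal_divisibility) (h12 : thm12_signedSelmerDual_finite_torsion)
    (hp : p ≠ 2) (hgood : W.HasGoodReductionAtPrime p) (hap : W.frobeniusTrace p = 0)
    {N : ℕ} [NeZero N] {f : CuspForm (Gamma0 N) 2} (hf : IsNewformOf W f)
    (hκ : κ.IsCyclotomic) (hγ : κ.IsTopGenerator γ) (hγ' : IsCyclotomicVariable p γ)
    {L : IwasawaAlgebra p} (hL : IsSignedPAdicLFunction f p ε L)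
    (D : SignedSelmerDualData W κ γ ε) [Module.Finite (IwasawaAlgebra p) D.X] :
    L.order = W.mordellWeilRank ↔
      Module.lengthAt (IwasawaAlgebra p) D.X (primeT p) = L.order ∧
        derivedLength p D.X 1 = 0 ∧ W.shaCorank p = 0 ∧
        coinvariantsRank p D.X = W.selmerCorank p := by
  have hX : Module.IsTorsion (IwasawaAlgebra p) D.X := h12.isTorsion hp hgood hap hκ hγ D
  have hid : W.selmerCorank p = W.mordellWeilRank + W.shaCorank p :=
    W.selmerCorank_eq_mordellWeilRank_add_holds p
  have hcrit := lengthAt_eq_coinvariantsRank_iff_derivedLength_one_eq_zero p D.X hX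
  constructor
  · intro hS
    obtain ⟨hsha, hctrl, hsel, hall, hMCT, -⟩ := defects_eq_zero_of_order_le_rank_signed p W h41 h12
      hp hgood hap hf hκ hγ hγ' hL D hS.le
    exact ⟨hMCT, hall 1 le_rfl, hsha, hctrl⟩
  · rintro ⟨hMCT, h1, hsha, hctrl⟩
    have hℓc : Module.lengthAt (IwasawaAlgebra p) D.X (primeT p) = coinvariantsRank p D.X := hcrit.mpr h1
    rw [← hMCT, hℓc, hctrl, hid, hsha, Nat.add_zero]

/-- **Exact defect decomposition under (MC_T^ε) and (CT^ε)**: for all large `n`,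
`ord_{X=0} L_p^ε = rank E(ℚ) + corank_{ℤ_p} Ш(E/ℚ)[p^∞] + ∑_{1 ≤ i ≤ n} e_{i+1}(X^ε(E/ℚ_∞))` and the profile is
eventually `0` (Bertolini–Darmon, signed). [cite: BertoliniDarmon1995, §2] [cite: Kobayashi2003, Thm. 9.3, Main Conj. (p. 2)] -/
theorem order_eq_rank_add_shaCorank_add_sum_derivedLength_of_MCT_signed
    (h12 : thm12_signedSelmerDual_finite_torsion)
    (hp : p ≠ 2) (hgood : W.HasGoodReductionAtPrime p) (hap : W.frobeniusTrace p = 0)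
    (hκ : κ.IsCyclotomic) (hγ : κ.IsTopGenerator γ) {L : IwasawaAlgebra p}
    (D : SignedSelmerDualData W κ γ ε) [Module.Finite (IwasawaAlgebra p) D.X]
    (hctrl : coinvariantsRank p D.X = W.selmerCorank p)
    (hMCT : Module.lengthAt (IwasawaAlgebra p) D.X (primeT p) = L.order) :
    ∃ n₀ : ℕ, ∀ n, n₀ ≤ n →
      L.order = (W.mordellWeilRank : ℕ∞) + W.shaCorank p +
          ∑ i ∈ Finset.Ico 1 (n + 1), derivedLength p D.X i ∧
        derivedLength p D.X (n + 1) = 0 := by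
  have hX : Module.IsTorsion (IwasawaAlgebra p) D.X := h12.isTorsion hp hgood hap hκ hγ D
  have hid : W.selmerCorank p = W.mordellWeilRank + W.shaCorank p :=
    W.selmerCorank_eq_mordellWeilRank_add_holds p
  obtain ⟨n₀, h⟩ := exists_lengthAt_eq_sum_derivedLength p D.X hX
  refine ⟨n₀, fun n hn ↦ ?_⟩
  obtain ⟨hsum, hzero⟩ := h (n + 1) (by omega)
  refine ⟨?_, hzero⟩
  rw [← hMCT, hsum, Finset.range_eq_Ico, Finset.sum_eq_sum_Ico_succ_bot (Nat.succ_pos n),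
    derivedLength_zero_eq_coinvariantsRank, hctrl, hid, Nat.cast_add]

/-- **Howard parity at a supersingular prime, algebraic side**: under (CT^ε), (MC_T^ε) and an even number
of blocks `Λ/(T²)` in `X^ε(E/ℚ_∞)` (Howard Cor. 5.3 — a HYPOTHESIS, stated for the signed structure),
`corank Sel_{p^∞}(E/ℚ) = 2` forces `ord_{X=0} L_p^ε = 2` or `≥ 4`. [cite: Howard2004DerivedHeights, Cor. 5.3]
[cite: Kobayashi2003, Thm. 9.3, Main Conj. (p. 2)] -/
theorem order_eq_two_or_four_le_of_MCT_of_even_blocks_two_signed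
    (h12 : thm12_signedSelmerDual_finite_torsion)
    (hp : p ≠ 2) (hgood : W.HasGoodReductionAtPrime p) (hap : W.frobeniusTrace p = 0)
    (hκ : κ.IsCyclotomic) (hγ : κ.IsTopGenerator γ) {L : IwasawaAlgebra p}
    (D : SignedSelmerDualData W κ γ ε) [Module.Finite (IwasawaAlgebra p) D.X]
    (hctrl : coinvariantsRank p D.X = W.selmerCorank p)
    (hMCT : Module.lengthAt (IwasawaAlgebra p) D.X (primeT p) = L.order)
    (hH : ∃ m : ℕ, derivedLength p D.X 1 = derivedLength p D.X 2 + 2 * (m : ℕ∞))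
    (hs : W.selmerCorank p = 2) :
    L.order = 2 ∨ 4 ≤ L.order := by
  have hX : Module.IsTorsion (IwasawaAlgebra p) D.X := h12.isTorsion hp hgood hap hκ hγ D
  have h2 : derivedLength p D.X 0 = 2 := by
    rw [derivedLength_zero_eq_coinvariantsRank, hctrl, hs, Nat.cast_ofNat]
  rw [← hMCT]
  exact lengthAt_eq_two_or_four_le_of_even_blocks_two p D.X hX hH h2

/-! ## §3 The leg (MC_T^ε) from the signed main conjecture in the tree's OPEN-binder currency -/

/-- **(MC_T^ε) from `SignedCharIdealEqPadicLFunctionNeron`** (the signed main conjecture in the tree's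
Néron-normalised OPEN-binder currency; [BurungaleSkinnerTianWan2024] Thm. 10.1 supplies it for semistable
`E`; a HYPOTHESIS here): for `f` the newform at level `N_W`, any `ϖ ∈ ℚ^×` with `ϖ · Ω_W = Ω_f^+` (tree:
`exists_ne_zero_rat_mul_realPeriodRat_eq_plusPeriod_of_facts`), every `L = L_p^ε` and datum `D`: `X^ε` is
`Λ`-torsion and `ℓ_{(T)}(X^ε(E/ℚ_∞)) = ord_{X=0} L_p^ε(E,X)`.
[cite: BurungaleSkinnerTianWan2024, Thm. 10.1 (p. 86; OPEN binder)] [cite: Kobayashi2003, Main Conj. (p. 2)]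
[cite: MazurTateTeitelbaum1986, §I.12] -/
theorem lengthAt_eq_order_of_signedCharIdealEq
    (hMC : SignedCharIdealEqPadicLFunctionNeron W p ε)
    (hκ : κ.IsCyclotomic) (hγ : κ.IsTopGenerator γ) (hγ' : IsCyclotomicVariable p γ)
    [NeZero (W.conductorNorm ℤ)] {f : CuspForm (Gamma0 (W.conductorNorm ℤ)) 2} (hf : IsNewformOf W f)
    {ϖ : ℚ} (hϖ0 : ϖ ≠ 0) (hϖ : (ϖ : ℝ) * W.realPeriodRat = plusPeriod f)
    {L : IwasawaAlgebra p} (hL : IsSignedPAdicLFunction f p ε L)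
    (D : SignedSelmerDualData W κ γ ε) [Module.Finite (IwasawaAlgebra p) D.X] :
    Module.IsTorsion (IwasawaAlgebra p) D.X ∧
      Module.lengthAt (IwasawaAlgebra p) D.X (primeT p) = L.order := by
  obtain ⟨hX, g, hg, hιg⟩ := hMC κ γ hκ hγ hγ' f hf ϖ hϖ L hL D
  refine ⟨hX, ?_⟩
  rw [← order_eq_of_iwasawaToPowerSeries_eq_C_mul p hϖ0 hιg,
    order_eq_toNat_lengthAt p hX g hg (primeT p) (primeT_asIdeal p),
    ENat.coe_toNat (lengthAt_primeT_ne_top D.X hX)]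

/-- **The door on the signed-main-conjecture locus.** Granted the two Kobayashi facts and the signed
main conjecture for `(W, p, ε)` (OPEN binder, hypothesis): `ord_{X=0} L_p^ε(E,X) = rank E(ℚ)` **iff**
`e_2(X^ε(E/ℚ_∞)) = 0 ∧ corank_{ℤ_p} Ш(E/ℚ)[p^∞] = 0 ∧ rank_{ℤ_p} X^ε/TX^ε = corank Sel_{p^∞}(E/ℚ)`.
[cite: BurungaleSkinnerTianWan2024, Thm. 10.1 (p. 86; OPEN binder)] [cite: Kobayashi2003, Thm. 4.1, Thm. 9.3]
[cite: Howard2004DerivedHeights, Cor. 5.3] [cite: BertoliniDarmon1995, §2] -/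
theorem order_eq_rank_iff_of_signedCharIdealEq
    (h41 : thm41_signedCharIdeal_divisibility) (h12 : thm12_signedSelmerDual_finite_torsion)
    (hMC : SignedCharIdealEqPadicLFunctionNeron W p ε)
    (hp : p ≠ 2) (hgood : W.HasGoodReductionAtPrime p) (hap : W.frobeniusTrace p = 0)
    (hκ : κ.IsCyclotomic) (hγ : κ.IsTopGenerator γ) (hγ' : IsCyclotomicVariable p γ)
    [NeZero (W.conductorNorm ℤ)] {f : CuspForm (Gamma0 (W.conductorNorm ℤ)) 2} (hf : IsNewformOf W f)
    {ϖ : ℚ} (hϖ0 : ϖ ≠ 0) (hϖ : (ϖ : ℝ) * W.realPeriodRat = plusPeriod f)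
    {L : IwasawaAlgebra p} (hL : IsSignedPAdicLFunction f p ε L)
    (D : SignedSelmerDualData W κ γ ε) [Module.Finite (IwasawaAlgebra p) D.X] :
    L.order = W.mordellWeilRank ↔
      derivedLength p D.X 1 = 0 ∧ W.shaCorank p = 0 ∧ coinvariantsRank p D.X = W.selmerCorank p := by
  have hMCT := (lengthAt_eq_order_of_signedCharIdealEq p W hMC hκ hγ hγ' hf hϖ0 hϖ hL D).2
  rw [order_eq_rank_iff_four_legs_signed p W h41 h12 hp hgood hap hf hκ hγ hγ' hL D]
  exact ⟨fun h ↦ h.2, fun h ↦ ⟨hMCT, h⟩⟩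

/-- **Semistable curves**: the door from the OPEN binder `thm101_signedMainStatement_semistable_OPEN`
([BurungaleSkinnerTianWan2024] Thm. 10.1, hypothesis `hBSTW`): `E` semistable, `p ≠ 2` good, `a_p = 0`, either
sign: `ord_{X=0} L_p^ε = rank E(ℚ) ⟺ e_2(X^ε) = 0 ∧ corank Ш[p^∞] = 0 ∧ (CT^ε)`.
[cite: BurungaleSkinnerTianWan2024, Thm. 10.1 (p. 86; OPEN binder)] [cite: Kobayashi2003, Thm. 4.1, Thm. 9.3] -/
theorem order_eq_rank_iff_of_thm101_OPEN_semistable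
    (h41 : thm41_signedCharIdeal_divisibility) (h12 : thm12_signedSelmerDual_finite_torsion)
    (hBSTW : thm101_signedMainStatement_semistable_OPEN) (hss : Rank1Residual.Semistable W)
    (hp : p ≠ 2) (hgood : W.HasGoodReductionAtPrime p) (hap : W.frobeniusTrace p = 0)
    (hκ : κ.IsCyclotomic) (hγ : κ.IsTopGenerator γ) (hγ' : IsCyclotomicVariable p γ)
    [NeZero (W.conductorNorm ℤ)] {f : CuspForm (Gamma0 (W.conductorNorm ℤ)) 2} (hf : IsNewformOf W f)
    {ϖ : ℚ} (hϖ0 : ϖ ≠ 0) (hϖ : (ϖ : ℝ) * W.realPeriodRat = plusPeriod f)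
    {L : IwasawaAlgebra p} (hL : IsSignedPAdicLFunction f p ε L)
    (D : SignedSelmerDualData W κ γ ε) [Module.Finite (IwasawaAlgebra p) D.X] :
    L.order = W.mordellWeilRank ↔
      derivedLength p D.X 1 = 0 ∧ W.shaCorank p = 0 ∧ coinvariantsRank p D.X = W.selmerCorank p :=
  order_eq_rank_iff_of_signedCharIdealEq p W h41 h12 (hBSTW W p hp hss hgood hap ε) hp hgood hap hκ hγ
    hγ' hf hϖ0 hϖ hL D

/-! ## §4 Every good prime `p ≥ 5`: the union with the ordinary file -/

/-- For `p ≥ 5` good, `E` is ordinary at `p` or `a_p = 0` (Hasse). [cite: Serre1981, §8.2] [cite: SilvermanAEC2009, Thm. V.1.1] -/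
theorem isOrdinaryAt_or_frobeniusTrace_eq_zero (hp5 : 5 ≤ p) (hgood : W.HasGoodReductionAtPrime p) :
    IsOrdinaryAt W p ∨ W.frobeniusTrace p = 0 := by
  by_cases h : (p : ℤ) ∣ W.frobeniusTrace p
  · exact Or.inr ((W.natCast_dvd_frobeniusTrace_iff_eq_zero p hp5 hgood).mp h)
  · exact Or.inl ⟨hgood, h⟩

/-- **Rank-≥ 2 `p`-adic BSD inequality at EVERY good prime `p ≥ 5` (K70-A ∪ K73-E).** For `W` globally
minimal, `f` its newform, `p ≥ 5` good and the cyclotomic variable `(κ, γ)`: EITHER `E` is ordinary at `p`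
and, granted `kato_divisibility W p` (Kato Thm. 17.4), for every Selmer-dual datum
`rank E(ℚ) + corank_{ℤ_p} Ш(E/ℚ)[p^∞] + e_2(X(E/ℚ_∞)) ≤ ord_{T=0} L_p(E,T)`; OR `a_p = 0` and, granted
Kobayashi's two facts, for both signs, every `L_p^ε` and every signed datum
`rank E(ℚ) + corank_{ℤ_p} Ш(E/ℚ)[p^∞] + e_2(X^ε(E/ℚ_∞)) ≤ ord_{X=0} L_p^ε(E,X)`. No Galois-image hypothesis,
no control theorem, no main conjecture. [cite: Kato2004Asterisque, Thm. 17.4 (p. 273)]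
[cite: Kobayashi2003, Thm. 4.1 (p. 8), Thm. 9.4 (p. 27)] [cite: Serre1981, §8.2] -/
theorem rank_add_shaCorank_le_order_at_every_good_prime_ge_five (hp5 : 5 ≤ p)
    (hgood : W.HasGoodReductionAtPrime p) {N : ℕ} [NeZero N] {f : CuspForm (Gamma0 N) 2}
    (hf : IsNewformOf W f) (hκ : κ.IsCyclotomic) (hγ : κ.IsTopGenerator γ)
    (hγ' : IsCyclotomicVariable p γ) :
    (IsOrdinaryAt W p ∧
        (kato_divisibility W p (κ := κ) (γ := γ) (f := f) → ∀ D : W.SelmerDualData κ γ,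
          (W.mordellWeilRank : ℕ∞) + W.shaCorank p + derivedLength p D.X 1 ≤
            (padicLFunction f (unitRoot W p : ℚ_[p])).order)) ∨
      (W.frobeniusTrace p = 0 ∧
        (thm41_signedCharIdeal_divisibility → thm12_signedSelmerDual_finite_torsion →
          ∀ (ε : ℤˣ) (L : IwasawaAlgebra p), IsSignedPAdicLFunction f p ε L →
            ∀ D : SignedSelmerDualData W κ γ ε,
              (W.mordellWeilRank : ℕ∞) + W.shaCorank p + derivedLength p D.X 1 ≤ L.order)) := by
  have hp2 : p ≠ 2 := by omega
  rcases isOrdinaryAt_or_frobeniusTrace_eq_zero p W hp5 hgood with hord | hap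
  · exact Or.inl ⟨hord, fun hK D ↦
      DerivedCoinvariantProfileDischarged.rank_add_shaCorank_add_derivedLength_one_le_order_of_kato p W f
        hK hp2 hord hκ hγ hγ' hf D⟩
  · exact Or.inr ⟨hap, fun h41 h12 ε L hL D ↦
      rank_add_shaCorank_add_derivedLength_one_le_order_signed p W h41 h12 hp2 hgood hap hf hκ hγ hγ'
        hL D⟩

end Summit.BirchSwinnertonDyer.BirchSwinnertonDyer.Theorems.DerivedCoinvariantProfileSigned
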